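import Summits.AtomisticToContinuum.FouriersLaw.Theses.CoercivePulse
import Summits.AtomisticToContinuum.FouriersLaw.Theorems.CoercivePulsePulseCalculusStubCovWindowMajorant
import Summits.AtomisticToContinuum.FouriersLaw.Theorems.CoercivePulsePulseCalculusStubPulseCurrentAsCovariance
import Summits.AtomisticToContinuum.FouriersLaw.Theorems.CoercivePulsePulseCalculusStubHelfandLocal
import Summits.AtomisticToContinuum.FouriersLaw.Theorems.CageBudgetFeketeHeatVarianceCalculus
import Summits.AtomisticToContinuum.FouriersLaw.Theorems.HoelderEscapeProfileAbelSpreadCeilingCanonicalTwin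
import Summits.AtomisticToContinuum.FouriersLaw.Theorems.HoelderEscapeProfileFibreCalculusStubTwiceIntegratedContinuity
import Summits.AtomisticToContinuum.FouriersLaw.Theorems.HoelderEscapeProfileFibreCalculusStubPolynomialHorizonCone
import Summits.AtomisticToContinuum.FouriersLaw.Theorems.HoelderEscapeProfileFibreCalculusStubWeightedClusteringTransfer
import Summits.AtomisticToContinuum.FouriersLaw.Theorems.EmbeddedDrudeMourreMourreDissolutionGibbsMixing
import Literature.Analysis.Asymptotics.LaplaceWindowBounds
import Literature.MathematicalPhysics.KineticTheory.TransportRegularityOfMixing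
import Literature.MathematicalPhysics.KineticTheory.InfiniteChainClusteringTransfer
import Literature.MathematicalPhysics.KineticTheory.InfiniteChainGeneratorLipschitz
import Literature.MathematicalPhysics.KineticTheory.InfiniteChainTwoPointContinuity
import Literature.MathematicalPhysics.KineticTheory.InfiniteChainCorrelationContinuity
import Literature.MathematicalPhysics.KineticTheory.InfiniteChainCurrentMoments
import Literature.MathematicalPhysics.KineticTheory.InfiniteChainEnergyDensityMoments
import Literature.MathematicalPhysics.KineticTheory.InfiniteChainGibbsInvariance
import Literature.MathematicalPhysics.KineticTheory.InfiniteChainShiftInvariantUniqueness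
import HarnessLib

/-!
# `CoercivePulse.PulseCalculus` — PROVED (item stmt-AtomisticToContinuum-15385, line `Sketch`, canonical reduction)

Sorry-free proof of the route item `Summit.AtomisticToContinuum.FouriersLaw.Theses.CoercivePulse.PulseCalculus`: the
infinite-volume calculus of the equilibrium energy pulse for EVERY guarded pair `(μ_T, D)` of the pinned anharmonic
chain `pinnedChain ω₂ lam β γ` (`ω₂, lam, β > 0`, `T > 0`; `μ_T` shift- and momentum-reversal-invariant DLR state,
`D` a `μ_T`-preserving a.e. shift-covariant infinite-volume dynamics; `h` the split-bond site energy,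
`S(x,t) = Cov(h_0, h_x∘φ_t)`, `M(t) = Σ_x x²S(x,t)`, `C_T = D.currentCorrelation μ_T`):
(1) absolutely convergent summed current correlations at every `t`; (2) `e^{−νt}C_T ∈ L¹(0,∞)` for every `ν > 0`;
(3) `Σ_x (1+x²)|S(x,t)| < ∞` at every `t`; (4) `M` continuous; (5) `e^{−νt}(M(t)−M(0)) ∈ L¹(0,∞)` and
`∫₀^∞e^{−νt}C_T = (ν²/2)∫₀^∞e^{−νt}(M(t)−M(0))` for every `ν > 0`.

## Proof architecture (line `Sketch`: crux ideas `stationary-orbits-stay-good`, `geometric-locality-majorant`,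
`generator-side-helfand`, all of whose heavy ingredients are landed)

* RIGIDITY (tree): the guarded `D` is a.e., at all times, the canonical Buttà–Marchioro dynamics `D♭`
  (`AbelSpreadCeiling.RegularityCollapse.stub_canonicalTwin`: carrier `bmGood`, measurable flow, identity off `bmGood`,
  `D♭.flow t =ᵐ[μ] D.flow t`, same `C_T`); hence `S` and the current pair correlations `G(x,t) = ∫ j_0 (j_x∘φ_t)dμ` of
  `D` ARE those of `D♭`.
* (1), (2) and the Laplace clause `∫e^{−νt}C_T = (ν²/2)∫e^{−νt}V_T`, `V_T(t) = 2∫_{(0,t]}(t−s)C_T(s)ds`: the PROVED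
  sibling item `CageBudgetFekete.HeatVarianceCalculus` (`heatVarianceCalculus_proof`, identical guard).
* Window majorants (landed stubs of this line): `stub_covWindowMajorant` (polynomial-horizon `L²` light cone ∘ weighted
  clustering transfer, for a local observable along `D♭`) at `a = h_0` and `a = j_0`, and `stub_pulseCurrentAsCovariance`
  (`S`, `G` as translated two-time covariances along `D♭`, continuity in `t`) give ONE majorant of `|S(·,t)|`, resp.
  `|G(·,t)|`, on every window `|t| ≤ τ`, with finite `(1+x²)`-moment: whence (3), and (4) by the window M-test.
* The LOCAL Helfand identity `M(t) − M(0) = 2∫_{(0,t]}(t−u)C_T(u)du` (`t > 0`): the landed per-site twice-integrated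
  conservation law along `D♭` (`FibreCalculusSketch.stub_twiceIntegratedContinuity`) and its `x²`-moment
  (`stub_helfandLocal`, pure real analysis: one `Σ_x`/`∫` exchange and `Σ_x x²ΔG = 2Σ_xG`); so `M(t) − M(0) = V_T(t)` on
  `(0,∞)` and (5) is HeatVarianceCalculus (d) rewritten.

[cite: ButtaMarchioro2016, §2 Thm 2.1, eq. (2.6) and §3] [cite: Helfand1960, §II]
[cite: BonettoLebowitzReyBellet2000, §7 eq. (37)] [cite: LanfordLebowitzLieb1977, §4]
-/

noncomputable section

namespace Summit.AtomisticToContinuum.FouriersLaw.Theorems.PulseCalculus.CanonicalReduction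

open MeasureTheory ProbabilityTheory Filter Topology Set Function
open Literature.MathematicalPhysics.KineticTheory.HeatConduction
open Literature.Analysis.Asymptotics
open Summit.AtomisticToContinuum.FouriersLaw.Theses.CoercivePulse (PulseCalculus)

/-- **The route item `CoercivePulse.PulseCalculus`, proved** (closes stmt-AtomisticToContinuum-15385) by the canonical
reduction: rigidity (canonical twin), the sibling item `HeatVarianceCalculus` for (1), (2) and the Laplace clause, the
window majorants of the pulse and of the current pair correlations (landed stubs `stub_covWindowMajorant`,
`stub_pulseCurrentAsCovariance`) for (3), (4), and the local Helfand identity (landed per-site law + `stub_helfandLocal`)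
for (5). -/
theorem pulseCalculus_proof : PulseCalculus := by
  have h1 := stub_covWindowMajorant
  have h2 := stub_pulseCurrentAsCovariance
  have h3 := stub_helfandLocal
  intro ω₂ lam β γ hω hl hβ T hT μ hG hSI hRefl D hP hShift h hh S hS
  /- (1), (2) and the Laplace clause: the sibling item `HeatVarianceCalculus` (identical guard) -/
  obtain ⟨hAC, -, hV⟩ :=
    Summit.AtomisticToContinuum.FouriersLaw.Theorems.HeatVarianceCalculus.CanonicalRigidity.heatVarianceCalculus_proof
      ω₂ lam β γ hω hl hβ T hT μ hG hSI hRefl D hP hShift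
  obtain ⟨-, hLap⟩ := hV _ rfl
  /- chain data -/
  have hss : (pinnedChain ω₂ lam β γ).HasSuperstabilityEstimate μ :=
    OscillatorChain.hasSuperstabilityEstimate_of_isShiftInvariant_pinnedChain γ hω hl.le hβ.le hT hG hSI
  haveI : IsProbabilityMeasure μ := hss.1
  have hU0 : ∀ q : ℝ, 0 ≤ (pinnedChain ω₂ lam β γ).U q := OscillatorChain.pinnedChain_U_nonneg β γ hω.le hl.le
  have hV0 : ∀ r : ℝ, 0 ≤ (pinnedChain ω₂ lam β γ).V r := OscillatorChain.pinnedChain_V_nonneg ω₂ lam γ hβ.le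
  have hUm : Measurable (pinnedChain ω₂ lam β γ).U := OscillatorChain.measurable_pinnedChain_U ω₂ lam β γ
  have hVm : Measurable (pinnedChain ω₂ lam β γ).V := OscillatorChain.measurable_pinnedChain_V ω₂ lam β γ
  have hU2 : OscillatorChain.IsEvenPolyOfDegree (pinnedChain ω₂ lam β γ).U 2 :=
    OscillatorChain.pinnedChain_isEvenPolyOfDegree_U β γ hω.le hl
  have hV2 : OscillatorChain.IsEvenPolyOfDegree (pinnedChain ω₂ lam β γ).V 2 :=
    OscillatorChain.pinnedChain_isEvenPolyOfDegree_V ω₂ lam γ hβ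
  /- RIGIDITY: the canonical twin `D'` of `D` -/
  obtain ⟨D', hcar, hmeas, hid, hP', hae, -, hCC⟩ :=
    Summit.AtomisticToContinuum.FouriersLaw.Theorems.AbelSpreadCeiling.RegularityCollapse.stub_canonicalTwin
      ω₂ lam β γ hω hl hβ T hT μ hG hSI hRefl D hP
  have hS' : S = fun (x : ℤ) (t : ℝ) =>
      ∫ σ, (h σ 0 - ∫ σ', h σ' 0 ∂μ) * (h (D'.flow t σ) x - ∫ σ', h σ' 0 ∂μ) ∂μ := by
    subst hS
    funext x t
    refine integral_congr_ae ?_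
    filter_upwards [hae t] with σ hσ
    rw [hσ]
  set G : ℤ → ℝ → ℝ := fun (x : ℤ) (t : ℝ) => ∫ σ, (pinnedChain ω₂ lam β γ).bondCurrentZ σ 0 *
      (pinnedChain ω₂ lam β γ).bondCurrentZ (D'.flow t σ) x ∂μ with hGdef
  have hCG : ∀ t : ℝ, D.currentCorrelation μ t = ∑' x : ℤ, G x t := by
    intro t
    rw [← hCC t]
    rfl
  /- the two generators `h₀`, `j₀` -/
  set h0 : ChainConfig → ℝ := fun σ => (pinnedChain ω₂ lam β γ).energyDensityZ σ 0 with h0def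
  set j0 : ChainConfig → ℝ := fun σ => (pinnedChain ω₂ lam β γ).bondCurrentZ σ 0 with j0def
  have h0m : Measurable h0 := (pinnedChain ω₂ lam β γ).measurable_energyDensityZ hUm hVm 0
  have j0m : Measurable j0 := measurable_bondCurrentZ _ 0
  have h0d : DependsOn h0 (Set.Icc (-1 : ℤ) 1) := OscillatorChain.dependsOn_energyDensityZ_zero _
  have j0d : DependsOn j0 (Set.Icc (-1 : ℤ) 1) := OscillatorChain.dependsOn_bondCurrentZ_zero _
  have h02 : MemLp h0 2 μ := hss.memLp_energyDensityZ hU0 hV0 hUm hVm 0 ENNReal.ofNat_ne_top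
  have j02 : MemLp j0 2 μ := hss.memLp_bondCurrentZ one_le_two hU0 hUm hV2 0 ENNReal.ofNat_ne_top
  have h04 : Integrable (fun σ => h0 σ ^ 4) μ := hss.integrable_energyDensityZ_pow_four hU0 hV0 hUm hVm 0
  have j04 : Integrable (fun σ => j0 σ ^ 4) μ := hss.integrable_bondCurrentZ_pow_four one_le_two hU0 hUm hV2 0
  obtain ⟨Ch, hCh, hLh⟩ := OscillatorChain.exists_polyLipschitz_energyDensityZ hU2 hV2
  obtain ⟨Cj, hCj, hLj⟩ := OscillatorChain.exists_polyLipschitz_bondCurrentZ (P := pinnedChain ω₂ lam β γ) hV2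
  /- S1 at `h₀` and `j₀`; S2 -/
  obtain ⟨Ah, mh, hWh⟩ := h1 ω₂ lam β γ hω hl hβ T hT μ hG hSI D' hcar hmeas h0 h0m h0d h02 h04 Ch
    (2 * 2 + 2 * 2 + 1) hCh hLh
  obtain ⟨Aj, mj, hWj⟩ := h1 ω₂ lam β γ hω hl hβ T hT μ hG hSI D' hcar hmeas j0 j0m j0d j02 j04 Cj
    (2 * 2 + 1) hCj hLj
  obtain ⟨hScov, hGcov, hScont, hGcont⟩ := h2 ω₂ lam β γ hω hl hβ T hT μ hG hSI D' hcar hmeas hid h hh S hS' G hGdef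
  /- window majorants of `S` and `G` -/
  have hwinS : ∀ τ : ℝ, 0 ≤ τ → ∃ F : ℤ → ℝ, (∀ x, 0 ≤ F x) ∧
      Summable (fun x : ℤ => (1 + (x : ℝ) ^ 2) * F x) ∧
      (∑' x : ℤ, (1 + (x : ℝ) ^ 2) * F x) ≤ Ah * (1 + τ) ^ mh ∧
      ∀ t : ℝ, |t| ≤ τ → ∀ x : ℤ, |S x t| ≤ F x := by
    intro τ hτ
    obtain ⟨F, hF0, hFs, hFb, hb⟩ := hWh τ hτ
    exact ⟨F, hF0, hFs, hFb, fun t ht x => by rw [hScov x t]; exact hb t ht x⟩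
  have hwinG : ∀ τ : ℝ, 0 ≤ τ → ∃ F : ℤ → ℝ, Summable (fun x : ℤ => (1 + (x : ℝ) ^ 2) * F x) ∧
      ∀ t : ℝ, |t| ≤ τ → ∀ x : ℤ, |G x t| ≤ F x := by
    intro τ hτ
    obtain ⟨F, -, hFs, -, hb⟩ := hWj τ hτ
    exact ⟨F, hFs, fun t ht x => by rw [hGcov x t]; exact hb t ht x⟩
  /- (3) -/
  have h3c : ∀ t : ℝ, Summable (fun x : ℤ => (1 + (x : ℝ) ^ 2) * |S x t|) := by
    intro t
    obtain ⟨F, hF0, hFs, -, hb⟩ := hwinS |t| (abs_nonneg t)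
    exact Summable.of_nonneg_of_le (fun x => by positivity)
      (fun x => mul_le_mul_of_nonneg_left (hb t le_rfl x) (by positivity)) hFs
  /- (4): window M-test -/
  have h4c : Continuous (fun t : ℝ => ∑' x : ℤ, (x : ℝ) ^ 2 * S x t) := by
    refine continuous_tsum_of_window_majorant (f := fun (x : ℤ) (t : ℝ) => (x : ℝ) ^ 2 * S x t)
      (fun x => continuous_const.mul (hScont x)) fun τ hτ => ?_
    obtain ⟨F, hF0, hFs, -, hb⟩ := hwinS τ hτ
    refine ⟨fun x => (1 + (x : ℝ) ^ 2) * F x, hFs, fun t ht x => ?_⟩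
    rw [abs_mul, abs_of_nonneg (sq_nonneg _)]
    exact mul_le_mul (by nlinarith [sq_nonneg (x : ℝ)]) (hb t ht x) (abs_nonneg _) (by positivity)
  /- the local Helfand identity: per-site law (tree) + S3, then `Σ_x G = C_T` -/
  have hper : ∀ (x : ℤ) (t : ℝ), 0 < t →
      S x t - S x 0 = ∫ u in Set.Ioc (0:ℝ) t, (t - u) * (G (x + 1) u - 2 * G x u + G (x - 1) u) :=
    fun x t ht =>
      Summit.AtomisticToContinuum.FouriersLaw.Theorems.FibreCalculusSketch.stub_twiceIntegratedContinuity
        ω₂ lam β γ hω hl hβ T hT μ hG hSI hRefl D' hcar hmeas hid h hh S hS' G hGdef x t ht.le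
  have hloc : ∀ t : ℝ, 0 < t →
      (∑' x : ℤ, (x : ℝ) ^ 2 * S x t) - (∑' x : ℤ, (x : ℝ) ^ 2 * S x 0) =
        2 * ∫ u in Set.Ioc (0:ℝ) t, (t - u) * D.currentCorrelation μ u := by
    intro t ht
    rw [h3 S G hGcont hwinG h3c hper t ht]
    simp only [hCG]
  /- (5): HeatVarianceCalculus (d) rewritten along the local identity -/
  refine ⟨hAC, fun ν hν => (hLap ν hν).1, h3c, h4c, fun ν hν => ?_⟩
  obtain ⟨-, hIV, hEq⟩ := hLap ν hν
  have hEqOn : EqOn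
      (fun t : ℝ => Real.exp (-(ν * t)) *
        (fun τ : ℝ => 2 * ∫ s in Set.Ioc (0:ℝ) τ, (τ - s) * D.currentCorrelation μ s) t)
      (fun t : ℝ => Real.exp (-(ν * t)) *
        ((∑' x : ℤ, (x : ℝ) ^ 2 * S x t) - (∑' x : ℤ, (x : ℝ) ^ 2 * S x 0))) (Ioi 0) := by
    intro t ht
    simp only [hloc t ht]
  refine ⟨hIV.congr_fun hEqOn measurableSet_Ioi, ?_⟩
  rw [hEq, setIntegral_congr_fun measurableSet_Ioi hEqOn]

end Summit.AtomisticToContinuum.FouriersLaw.Theorems.PulseCalculus.CanonicalReduction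

end
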